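import Summits.RiemannHypothesis.RiemannHypothesis.Theorems.IntegerScrewCensusFloor96B

/-!
# Route `IntegerScrew` — census cell `M096-T375-dd` in the kernel: the DUAL checker on the cells `44 ≤ c < 77` (part C)

KERNEL FACTS (`decide +kernel`): `dualCheckW 95 375 40 EB 6000 a b … = true` on sub-ranges of `[44, 77)` for the dual
certificate literal `dpats96/deps96` of `IntegerScrewCensusFloor96A`.  RH-free; nothing here bears on the truth of RH.
-/

set_option linter.dupNamespace false
set_option autoImplicit false

namespace Summit.RiemannHypothesis.RiemannHypothesis.Theorems.IntegerScrew.Manifest.Fast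

open Literature.Analysis.ValidatedNumerics Literature.Analysis.ValidatedNumerics.Numerics

set_option maxRecDepth 200000 in
set_option maxHeartbeats 0 in
/-- KERNEL FACT: the cells `44 ≤ c < 55` pass. -/
theorem dualCheckW_96_44_55 : dualCheckW 95 375 40 EB 6000 44 55 logs113s dpats96 deps96 = true := by
  decide +kernel

set_option maxRecDepth 200000 in
set_option maxHeartbeats 0 in
/-- KERNEL FACT: the cells `55 ≤ c < 66` pass. -/
theorem dualCheckW_96_55_66 : dualCheckW 95 375 40 EB 6000 55 66 logs113s dpats96 deps96 = true := by
  decide +kernel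

set_option maxRecDepth 200000 in
set_option maxHeartbeats 0 in
/-- KERNEL FACT: the cells `66 ≤ c < 77` pass. -/
theorem dualCheckW_96_66_77 : dualCheckW 95 375 40 EB 6000 66 77 logs113s dpats96 deps96 = true := by
  decide +kernel

end Summit.RiemannHypothesis.RiemannHypothesis.Theorems.IntegerScrew.Manifest.Fast
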